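import Literature.Computability.QuantumComplexity.HadamardGadgetPhases
import Mathlib.Data.Nat.Size
import HarnessLib

/-!
# Uniformity of the Hadamard-gadget family, VI: the whole machine and its `FP` statement

Topic `Literature/Computability/QuantumComplexity`; sixth of the files proving that the compiled
post-selected IQP family `HGadget.Hop.gadgetFamily F` is uniform (Bremner–Jozsa–Shepherd 2011,
proof of Thm. 1 with Def. 1). The phases of `HadamardGadgetPhases.lean` and the gate loop of
`HadamardGadgetLoop.lean` are put in sequence (`prog`); the functional model `progM` of the final
state is given on an ARBITRARY input (the lexer's stream or not), `runs_prog` proves that the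
program reaches it from the initial state within `progCost |z|` steps, a polynomial, and
`progFn_mem_FP` / `plFn_mem_FP` conclude by `Com.mem_FP` that the printed description (register `res`)
and the unary post-selection length (register `pl`) are `FP` functions of the input stream.

## References

* M. J. Bremner, R. Jozsa, D. J. Shepherd, Proc. R. Soc. A 467 (2011) 459–472, Def. 1, Thm. 1.
* S. Arora, B. Barak, *Computational Complexity: A Modern Approach*, CUP 2009, §1.3, §6.2.
-/

namespace Literature.Computability.QuantumComplexity

open _root_.Computability Complexity Complexity.Com Cryptography Thm25Lex
open Thm25Asm (IsFlag isFlag_nil isFlag_true isFlag_flag)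

namespace HGadget.Hop

namespace Asm

/-! ### The program -/

/-- The prefix and set-up part of the machine: prefix loops, constants, initial layer.
[cite: BremnerJozsaShepherdPRSA2011, Thm. 1 (proof) with Def. 1] -/
def progSetup : Com R := pre1 ;; pre2 ;; Com.pour .t .nB ;; pre3 ;; mkNU ;; mkX ;; mkLU ;; mkSU ;; mkConsts ;; initA ;; initB

/-- **The whole program**: set-up, then the gate loop and the final layer, then the outputs.
[cite: BremnerJozsaShepherdPRSA2011, Thm. 1 (proof) with Def. 1] -/
def prog : Com R := progSetup ;; ((gateLoop ;; finalLayer) ;; (output ;; outputPl))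

/-! ### The quantities read off an arbitrary input -/

section Model

variable (z : List Bool)

/-- `n`: the ones of the first unary block. [folklore] -/
def nOf : ℕ := (pre1M z).1
/-- the announced bits (the numeral of `n` on a well-formed input). [folklore] -/
def uOf : List Bool := (pre2M (pre1M z).2).1
/-- `m`: the ones of the second unary block. [folklore] -/
def mOf : ℕ := (pre1M (pre2M (pre1M z).2).2).1
/-- the token stream of the gate list. [folklore] -/
def toksOf : List Bool := (pre1M (pre2M (pre1M z).2).2).2
/-- `N = n + m`. [folklore] -/
def NOf : ℕ := nOf z + mOf z
/-- `L = |bin (N + 1)|`. [folklore] -/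
def LOf : ℕ := (encodeNat (NOf z + 1)).length
/-- The size bound of the gate loop. [folklore] -/
def KOf : ℕ := (LOf z + 3) * ((toksOf z).length + 15)

/-- The sizes are bounded by the input length. [folklore] -/
theorem sizes_le : nOf z + (uOf z).length + mOf z + (toksOf z).length ≤ z.length := by
  have h1 := pre1M_len z
  have h2 := pre2M_len (pre1M z).2
  have h3 := pre1M_len (pre2M (pre1M z).2).2
  unfold nOf uOf mOf toksOf; omega

/-- **The state entering the gate loop.** [folklore] -/
def preLoop : St where
  inp := []
  g1 := []
  g2 := []
  g := toksOf z
  nU := List.replicate (nOf z) true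
  nB := uOf z
  n1B := []
  mU := List.replicate (mOf z) true
  NU := List.replicate (NOf z) true
  x := encodeNat (NOf z + 1)
  LU := List.replicate (LOf z) true
  lc := List.replicate (LOf z) true
  k1 := encodeNat 1
  sB := encodeNat 2
  s1 := encodeNat 3
  s2 := encodeNat 4
  sfU := [true, true, true]
  wa := []
  w1 := []
  w2 := []
  f1 := []
  iC := encodeNat (nOf z)
  iF := numF (LOf z) (NOf z)
  cU := []
  SU := List.replicate (2 ^ LOf z) true
  t3 := []
  o := (hopTextFrom (LOf z) (nOf z) (mOf z) (encodeNat 1) (encodeNat 2)).reverse ++ (initAText (LOf z) (nOf z) (encodeNat 2)).reverse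
  res := []
  pl := []
  t := []
  t2 := []
  fl := []

/-- The state after the gate loop. [folklore] -/
def postLoop : St := loopM (LOf z) (NOf z) (toksOf z) (preLoop z)

/-- The state after the final layer. [folklore] -/
def postFinal : St :=
  { postLoop z with
    o := (finalText (LOf z) (NOf z) (postLoop z).sB (postLoop z).s1 (uOf z) (TokConv.incRes true (uOf z))).reverse ++ (postLoop z).o
    n1B := TokConv.incRes true (uOf z)
    iF := numF (LOf z) (NOf z)
    cU := [] }

/-- The printed description. [cite: BremnerJozsaShepherdPRSA2011, Def. 1] -/
def resOf : List Bool :=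
  rep 2 (uOf z) ++ (false :: true :: (List.replicate (2 * (2 ^ LOf z * (postLoop z).sfU.length + mOf z)) true ++ (false :: true :: (postFinal z).o.reverse)))

/-- **The final state of the machine.** [folklore] -/
def progM : St :=
  { postFinal z with o := [], nB := [], t := [], res := resOf z, pl := List.replicate (2 ^ LOf z * (postLoop z).sfU.length + 1 - nOf z) true }

/-- **The description function computed by the machine.** [cite: BremnerJozsaShepherdPRSA2011, Def. 1] -/
def progFn : List Bool := (progM z).res

/-- **The post-selection length (unary) computed by the machine.** [cite: BremnerJozsaShepherdPRSA2011, Def. 3] -/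
def plFn : List Bool := (progM z).pl

end Model

/-! ### What the gate loop keeps -/

/-- The registers the gate loop never touches, and the shape of `sfU`. [folklore] -/
structure Keeps (s s' : St) : Prop where
  /-- `nU` -/
  hnU : s'.nU = s.nU
  /-- `nB` -/
  hnB : s'.nB = s.nB
  /-- `n1B` -/
  hn1B : s'.n1B = s.n1B
  /-- `mU` -/
  hmU : s'.mU = s.mU
  /-- `NU` -/
  hNU : s'.NU = s.NU
  /-- `LU` -/
  hLU : s'.LU = s.LU
  /-- `k1` -/
  hk1 : s'.k1 = s.k1
  /-- `SU` -/
  hSU : s'.SU = s.SU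
  /-- `res` -/
  hres : s'.res = s.res
  /-- `pl` -/
  hpl : s'.pl = s.pl
  /-- `t` -/
  ht : s'.t = s.t
  /-- `t2` -/
  ht2 : s'.t2 = s.t2
  /-- `t3` -/
  ht3 : s'.t3 = s.t3
  /-- `fl` -/
  hfl : s'.fl = s.fl
  /-- `sfU` only gains ticks -/
  hsfU : ∃ j, s'.sfU = List.replicate j true ++ s.sfU

/-- `Keeps` is reflexive. [folklore] -/
theorem Keeps.rfl' (s : St) : Keeps s s := ⟨rfl, rfl, rfl, rfl, rfl, rfl, rfl, rfl, rfl, rfl, rfl, rfl, rfl, rfl, ⟨0, rfl⟩⟩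

/-- `Keeps` is transitive. [folklore] -/
theorem Keeps.trans {a b c : St} (h1 : Keeps a b) (h2 : Keeps b c) : Keeps a c := by
  obtain ⟨j1, hj1⟩ := h1.hsfU
  obtain ⟨j2, hj2⟩ := h2.hsfU
  exact ⟨h2.hnU.trans h1.hnU, h2.hnB.trans h1.hnB, h2.hn1B.trans h1.hn1B, h2.hmU.trans h1.hmU, h2.hNU.trans h1.hNU, h2.hLU.trans h1.hLU,
    h2.hk1.trans h1.hk1, h2.hSU.trans h1.hSU, h2.hres.trans h1.hres, h2.hpl.trans h1.hpl, h2.ht.trans h1.ht, h2.ht2.trans h1.ht2,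
    h2.ht3.trans h1.ht3, h2.hfl.trans h1.hfl, ⟨j2 + j1, by rw [hj2, hj1, ← List.append_assoc, List.replicate_add]⟩⟩

/-- Shortening the stream keeps. [folklore] -/
theorem Keeps.with_g (s : St) (g : List Bool) : Keeps s { s with g := g } := ⟨rfl, rfl, rfl, rfl, rfl, rfl, rfl, rfl, rfl, rfl, rfl, rfl, rfl, rfl, ⟨0, rfl⟩⟩

/-- Every handler keeps. [folklore] -/
theorem keeps_actM (L N : ℕ) (a b d : Bool) (s : St) : Keeps s (actM L N a b d s) := by
  cases a <;> cases b <;> cases d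
  · exact ⟨rfl, rfl, rfl, rfl, rfl, rfl, rfl, rfl, rfl, rfl, rfl, rfl, rfl, rfl, ⟨0, rfl⟩⟩
  · exact ⟨rfl, rfl, rfl, rfl, rfl, rfl, rfl, rfl, rfl, rfl, rfl, rfl, rfl, rfl, ⟨0, rfl⟩⟩
  · simp only [actM, hSEPM, commitM, padM]
    split_ifs <;> exact ⟨rfl, rfl, rfl, rfl, rfl, rfl, rfl, rfl, rfl, rfl, rfl, rfl, rfl, rfl, ⟨0, rfl⟩⟩
  · exact ⟨rfl, rfl, rfl, rfl, rfl, rfl, rfl, rfl, rfl, rfl, rfl, rfl, rfl, rfl, ⟨0, rfl⟩⟩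
  · exact ⟨rfl, rfl, rfl, rfl, rfl, rfl, rfl, rfl, rfl, rfl, rfl, rfl, rfl, rfl, ⟨2, rfl⟩⟩
  · exact ⟨rfl, rfl, rfl, rfl, rfl, rfl, rfl, rfl, rfl, rfl, rfl, rfl, rfl, rfl, ⟨2, rfl⟩⟩
  · exact ⟨rfl, rfl, rfl, rfl, rfl, rfl, rfl, rfl, rfl, rfl, rfl, rfl, rfl, rfl, ⟨2, rfl⟩⟩
  · exact ⟨rfl, rfl, rfl, rfl, rfl, rfl, rfl, rfl, rfl, rfl, rfl, rfl, rfl, rfl, ⟨6, rfl⟩⟩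

/-- **The gate loop keeps.** [folklore] -/
theorem keeps_loopM (L N : ℕ) : ∀ (g : List Bool) (s : St), Keeps s (loopM L N g s)
  | [], s => Keeps.with_g s []
  | [_], s => Keeps.with_g s []
  | [_, _], s => Keeps.with_g s []
  | a :: b :: d :: g, s => by
    rw [loopM_cons₃]
    exact ((Keeps.with_g s g).trans (keeps_actM L N a b d _)).trans (keeps_loopM L N g _)

/-- **The gate loop preserves the invariant** (and empties the stream). [folklore] -/
theorem inv_loopM {L N K : ℕ} : ∀ (g : List Bool) (s : St), Inv L N K s → s.g = g → Inv L N K (loopM L N g s)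
  | [], s, hI, hg => by rw [loopM_nil]; exact hI.of_g (by simp)
  | [_], s, hI, hg => by rw [loopM_one]; exact hI.of_g (by simp)
  | [_, _], s, hI, hg => by rw [loopM_two]; exact hI.of_g (by simp)
  | a :: b :: d :: g, s, hI, hg => by
    rw [loopM_cons₃]
    exact inv_loopM g _ (inv_actM a b d s g hI hg) (actM_g _ _ _ _)

/-- The stream register is empty after the loop. [folklore] -/
theorem loopM_g (L N : ℕ) : ∀ (g : List Bool) (s : St), (loopM L N g s).g = []
  | [], _ => rfl
  | [_], _ => rfl
  | [_, _], _ => rfl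
  | a :: b :: d :: g, s => by rw [loopM_cons₃]; exact loopM_g L N g _

/-! ### A generic size bound: `t` steps add at most `t` symbols -/

section Tot

variable {ι : Type} [DecidableEq ι] [Fintype ι]

/-- The total number of symbols on the register file. [folklore] -/
def tot (Rg : Regs ι) : ℕ := Finset.univ.sum fun k => (Rg k).length

/-- Updating one register changes the total by the difference of lengths. [folklore] -/
theorem tot_update (Rg : Regs ι) (k : ι) (v : List Bool) : tot (Function.update Rg k v) + (Rg k).length = tot Rg + v.length := by
  unfold tot
  have h : (fun j => (Function.update Rg k v j).length) = Function.update (fun j => (Rg j).length) k v.length := by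
    funext j; by_cases hj : j = k
    · subst hj; simp
    · simp [Function.update_of_ne hj]
  rw [h, Finset.sum_update_of_mem (Finset.mem_univ k), ← Finset.add_sum_erase _ (fun j => (Rg j).length) (Finset.mem_univ k),
    Finset.sdiff_singleton_eq_erase]
  omega

/-- Popping a bit lowers the total by one. [folklore] -/
theorem tot_pop {Rg : Regs ι} {k : ι} {b : Bool} {w : List Bool} (hk : Rg k = b :: w) : tot (Function.update Rg k w) + 1 = tot Rg := by
  have := tot_update Rg k w; rw [hk, List.length_cons] at this; omega

/-- **An execution of `t` steps increases the total size by at most `t`.** [cite: AroraBarak2009, §1.3 (a step writes one symbol)] -/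
theorem tot_le_of_exec {c : Com ι} {Rg : Regs ι} {st : Bool} {Rg' : Regs ι} {t : ℕ} (h : Com.Exec c Rg st Rg' t) : tot Rg' ≤ tot Rg + t := by
  induction h with
  | @push k b Rg => have := tot_update Rg k (b :: Rg k); simp only [List.length_cons] at this; omega
  | pop_true hk _ ih => have := tot_pop hk; omega
  | pop_false hk _ ih => have := tot_pop hk; omega
  | pop_nil _ _ ih => omega
  | seq _ _ ih1 ih2 => omega
  | seq_stop _ ih => omega
  | skip => omega
  | loop_nil _ => omega
  | loop_true hk _ _ ih1 ih2 => have := tot_pop hk; omega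
  | loop_true_stop hk _ ih => have := tot_pop hk; omega
  | loop_false hk _ _ ih1 ih2 => have := tot_pop hk; omega
  | loop_false_stop hk _ ih => have := tot_pop hk; omega
  | halt => omega

/-- **A register after a run is at most the initial total plus the budget long.** [folklore] -/
theorem length_le_of_runs {c : Com ι} {Rg Rg' : Regs ι} {B : ℕ} (h : Runs c Rg Rg' B) (k : ι) : (Rg' k).length ≤ tot Rg + B := by
  obtain ⟨t, ht, e⟩ := h
  have h1 := tot_le_of_exec e
  have h2 : (Rg' k).length ≤ tot Rg' := Finset.single_le_sum (f := fun k => (Rg' k).length) (fun _ _ => Nat.zero_le _) (Finset.mem_univ k)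
  omega

/-- The initial register file has total size `|z|`. [folklore] -/
theorem tot_init (i : ι) (z : List Bool) : tot (Regs.init i z) = z.length := by
  unfold tot Regs.init
  rw [Finset.sum_eq_single i (fun k _ hk => by simp [hk]) (fun h => absurd (Finset.mem_univ i) h)]
  simp

end Tot

/-! ### Bounds -/

/-- `|bin v| = size v` (as in `TM2PassThrough.lean`, through the normal form of `StackArith.lean`). [folklore] -/
theorem length_encodeNat_eq_size' (v : ℕ) : (encodeNat v).length = v.size := by
  rw [← norm_encodeNat, length_norm, bitsToNat_encodeNat]

/-- `2^L ≤ 2 (N + 1)` for `L = |bin (N + 1)|`. [folklore] -/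
theorem two_pow_LOf_le (z : List Bool) : 2 ^ LOf z ≤ 2 * (NOf z + 1) := by
  unfold LOf
  rw [length_encodeNat_eq_size']
  have h1 : 0 < (NOf z + 1).size := Nat.size_pos.2 (Nat.succ_pos _)
  have h2 : 2 ^ ((NOf z + 1).size - 1) ≤ NOf z + 1 := Nat.lt_size.1 (by omega)
  calc 2 ^ (NOf z + 1).size = 2 * 2 ^ ((NOf z + 1).size - 1) := by rw [← Nat.pow_succ']; congr 1; omega
    _ ≤ 2 * (NOf z + 1) := Nat.mul_le_mul_left 2 h2

/-- `L ≤ N + 1`. [folklore] -/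
theorem LOf_le (z : List Bool) : LOf z ≤ NOf z + 1 := TokConv.length_encodeNat_le _

/-- `N ≤ |z|`. [folklore] -/
theorem NOf_le (z : List Bool) : NOf z ≤ z.length := by have := sizes_le z; unfold NOf; omega

/-- **The invariant holds when the gate loop is entered.** [folklore] -/
theorem inv_preLoop (z : List Bool) : Inv (LOf z) (NOf z) (KOf z) (preLoop z) := by
  have hK : KOf z = LOf z * (toksOf z).length + 15 * LOf z + 3 * (toksOf z).length + 45 := by unfold KOf; ring
  refine ⟨⟨rfl, rfl, rfl, rfl, rfl⟩, isFlag_nil, ⟨LOf z, le_rfl, rfl⟩, ⟨2, ⟨rfl, rfl, rfl⟩, ?_⟩, by simp [preLoop], rfl, ?_⟩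
  · show 2 + 2 * (toksOf z).length + 13 ≤ KOf z
    rw [hK]; nlinarith [Nat.zero_le (LOf z * (toksOf z).length), Nat.zero_le (LOf z)]
  · show ([] : List Bool).length + ([] : List Bool).length + ([] : List Bool).length + (LOf z + 1) * (toksOf z).length ≤ KOf z
    rw [hK, List.length_nil]; nlinarith [Nat.zero_le (LOf z), Nat.zero_le (toksOf z).length]

/-! ### The set-up reaches `preLoop` -/

/-- The exact cost of the set-up as a function of the sizes `ℓ = |z|`, `u = |bin n|`, `n`, `m`, `N`, `L`
and `S = 2^L`. [folklore] -/
def setupCostF (ℓ u n m N L S : ℕ) : ℕ :=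
  (6 * ℓ + 3) + (6 * ℓ + 3) + (3 * u + 1) + (6 * ℓ + 3) + (10 * n + 10 * m + 6) +
    (10 * N + 3 + (N * (9 * N + 11) + 1) + (9 * N + 18)) + (10 * L + 3 + (L * 3 + 1)) +
    (1 + (10 * L + 3) + (L * (16 * S + 7) + 1)) + (10 * L + 170) +
    (2 * 0 + 13 * L + 7 + (10 * n + 3) + (n * (48 * n + 29 * L + 10 * 2 + 70) + 1)) +
    (10 * m + 3 + (m * (29 * L + 20 * 2 + 47) + 1))

/-- The exact cost of the set-up, in the quantities read off the input. [folklore] -/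
def setupCost (z : List Bool) : ℕ := setupCostF z.length (uOf z).length (nOf z) (mOf z) (NOf z) (LOf z) (2 ^ LOf z)

/-- `1ᵐ ++ 1ⁿ = 1ᴺ`. [folklore] -/
theorem replicate_mOf_append_nOf (z : List Bool) :
    List.replicate (mOf z) true ++ List.replicate (nOf z) true = List.replicate (NOf z) true := by
  rw [← List.replicate_add, NOf, Nat.add_comm]

/-- **The set-up runs from the initial state to `preLoop z`, on every input.** [folklore] -/
theorem runs_progSetup (z : List Bool) : Runs progSetup (St.init z).regs (preLoop z).regs (setupCost z) := by
  -- the prefix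
  have e1 : Runs pre1 (St.init z).regs ({ St.init z with inp := [], nU := List.replicate (nOf z) true, g1 := (pre1M z).2 } : St).regs (6 * z.length + 3) :=
    (runs_pre1 z (St.init z) rfl rfl rfl).of_eq (by simp [St.init, nOf]) le_rfl
  have e2 : Runs pre2 ({ St.init z with inp := [], nU := List.replicate (nOf z) true, g1 := (pre1M z).2 } : St).regs
      ({ St.init z with inp := [], nU := List.replicate (nOf z) true, g1 := [], t := (uOf z).reverse, g2 := (pre2M (pre1M z).2).2 } : St).regs
      (6 * z.length + 3) :=
    (runs_pre2 _ _ rfl rfl rfl).of_eq (by simp [St.init, uOf]) (by have := pre1M_len z; simp only []; omega)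
  have e3 : Runs (Com.pour R.t R.nB)
      ({ St.init z with inp := [], nU := List.replicate (nOf z) true, g1 := [], t := (uOf z).reverse, g2 := (pre2M (pre1M z).2).2 } : St).regs
      ({ St.init z with inp := [], nU := List.replicate (nOf z) true, g1 := [], t := [], nB := uOf z, g2 := (pre2M (pre1M z).2).2 } : St).regs
      (3 * (uOf z).length + 1) :=
    (runs_pour (a := R.t) (b := R.nB) (by decide) _).of_eq (by rw [St.upd_t, St.upd_nB]; simp [St.init]) (by simp)
  have e4 : Runs pre3
      ({ St.init z with inp := [], nU := List.replicate (nOf z) true, g1 := [], t := [], nB := uOf z, g2 := (pre2M (pre1M z).2).2 } : St).regs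
      ({ St.init z with inp := [], nU := List.replicate (nOf z) true, g1 := [], t := [], nB := uOf z, g2 := [], mU := List.replicate (mOf z) true, g := toksOf z } : St).regs
      (6 * z.length + 3) :=
    (runs_pre3 _ _ rfl rfl rfl).of_eq (by simp [St.init, mOf, toksOf]) (by have := pre1M_len z; have := pre2M_len (pre1M z).2; simp only []; omega)
  -- abbreviate the state after the prefix
  set s4 : St := { St.init z with inp := [], nU := List.replicate (nOf z) true, g1 := [], t := [], nB := uOf z, g2 := [], mU := List.replicate (mOf z) true, g := toksOf z }
    with hs4
  have e5 : Runs mkNU s4.regs ({ s4 with NU := List.replicate (NOf z) true } : St).regs (10 * nOf z + 10 * mOf z + 6) :=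
    (runs_mkNU s4 rfl rfl).of_eq (by simp [hs4, St.init, NOf, Nat.add_comm]) (by simp [hs4])
  have e6 : Runs mkX ({ s4 with NU := List.replicate (NOf z) true } : St).regs ({ s4 with NU := List.replicate (NOf z) true, x := encodeNat (NOf z + 1) } : St).regs
      (10 * NOf z + 3 + (NOf z * (9 * NOf z + 11) + 1) + (9 * NOf z + 18)) :=
    (runs_mkX _ (NOf z) rfl rfl rfl rfl rfl rfl).of_eq (by simp [hs4, St.init]) le_rfl
  have e7 : Runs mkLU ({ s4 with NU := List.replicate (NOf z) true, x := encodeNat (NOf z + 1) } : St).regs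
      ({ s4 with NU := List.replicate (NOf z) true, x := encodeNat (NOf z + 1), LU := List.replicate (LOf z) true } : St).regs
      (10 * LOf z + 3 + (LOf z * 3 + 1)) :=
    (runs_mkLU _ rfl rfl rfl rfl).of_eq (by simp [hs4, St.init, LOf]) (by simp [LOf])
  have e8 : Runs mkSU ({ s4 with NU := List.replicate (NOf z) true, x := encodeNat (NOf z + 1), LU := List.replicate (LOf z) true } : St).regs
      ({ s4 with NU := List.replicate (NOf z) true, x := encodeNat (NOf z + 1), LU := List.replicate (LOf z) true, SU := List.replicate (2 ^ LOf z) true } : St).regs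
      (1 + (10 * LOf z + 3) + (LOf z * (16 * 2 ^ LOf z + 7) + 1)) :=
    (runs_mkSU _ (LOf z) rfl rfl rfl rfl rfl rfl).of_eq (by simp [hs4, St.init]) le_rfl
  set s8 : St := { s4 with NU := List.replicate (NOf z) true, x := encodeNat (NOf z + 1), LU := List.replicate (LOf z) true, SU := List.replicate (2 ^ LOf z) true }
    with hs8
  have hE8 : Env (LOf z) (NOf z) s8 := ⟨rfl, rfl, rfl, rfl, rfl⟩
  have e9 := runs_mkConsts s8 hE8 rfl rfl rfl rfl rfl rfl
  set s9 : St := { s8 with k1 := encodeNat 1, sB := encodeNat 2, s1 := encodeNat 3, s2 := encodeNat 4, sfU := [true, true, true], lc := List.replicate (LOf z) true } with hs9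
  have hE9 : Env (LOf z) (NOf z) s9 := ⟨rfl, rfl, rfl, rfl, rfl⟩
  have e10 := runs_initA s9 (nOf z) hE9 rfl rfl rfl
  have h2 : (encodeNat 2).length = 2 := by decide
  have h1 : (encodeNat 1).length = 1 := by decide
  have e11 := runs_initB ({ s9 with o := (initAText (LOf z) (nOf z) s9.sB).reverse ++ s9.o, iC := encodeNat (nOf z), iF := numF (LOf z) (nOf z), cU := ([] : List Bool) } : St)
    (nOf z) (mOf z) 2 rfl rfl rfl rfl rfl rfl (by simp [hs9, h1]) (by simp [hs9, h2])
  refine (e1.seq (e2.seq (e3.seq (e4.seq (e5.seq (e6.seq (e7.seq (e8.seq (e9.seq (e10.seq e11)))))))))).of_eq ?_ ?_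
  · simp [hs9, hs8, hs4, St.init, preLoop, NOf]
  · simp only [hs9, hs8, hs4, St.init, h2, List.length_nil, setupCost, setupCostF]
    omega

/-! ### The gate loop and the final layer reach `postFinal` -/

/-- The numeral bound of the final layer. [folklore] -/
def BOf (z : List Bool) : ℕ := KOf z + (uOf z).length + 1

/-- The cost of the gate loop and the final layer as a function of `g = |tokens|`, `L`, `N`, `K`, `B`. [folklore] -/
def loopFinalCostF (g L N K B : ℕ) : ℕ := g * (handlerCost L N K + 6) + 7 + finalCost L N B

/-- The cost of the gate loop and the final layer. [folklore] -/
def loopFinalCost (z : List Bool) : ℕ := loopFinalCostF (toksOf z).length (LOf z) (NOf z) (KOf z) (BOf z)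

/-- Facts about the state after the gate loop. [folklore] -/
theorem postLoop_facts (z : List Bool) :
    Inv (LOf z) (NOf z) (KOf z) (postLoop z) ∧ Keeps (preLoop z) (postLoop z) :=
  ⟨inv_loopM _ _ (inv_preLoop z) rfl, keeps_loopM _ _ _ _⟩

/-- **The gate loop and the final layer run from `preLoop z` to `postFinal z`.** [folklore] -/
theorem runs_loopFinal (z : List Bool) : Runs (gateLoop ;; finalLayer) (preLoop z).regs (postFinal z).regs (loopFinalCost z) := by
  unfold loopFinalCost loopFinalCostF
  obtain ⟨hI, hKp⟩ := postLoop_facts z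
  have e1 := runs_gateLoop (toksOf z) (preLoop z) (inv_preLoop z) rfl
  change Runs gateLoop (preLoop z).regs (postLoop z).regs _ at e1
  obtain ⟨c, hst, hc⟩ := hI.hst
  have hcl : (encodeNat c).length ≤ KOf z := (TokConv.length_encodeNat_le c).trans (by omega)
  have hcl1 : (encodeNat (c + 1)).length ≤ KOf z := (TokConv.length_encodeNat_le (c + 1)).trans (by omega)
  have hnB : (postLoop z).nB = uOf z := hKp.hnB
  have e2 := runs_finalLayer (L := LOf z) (N := NOf z) (postLoop z) (BOf z) hI.hE (hKp.hn1B.trans rfl) hI.hcU hI.hiF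
    (by rw [hnB]; unfold BOf; omega) (by rw [hnB]; unfold BOf; have := TokConv.length_incRes_le true (uOf z); omega)
    (by rw [hst.hsB]; unfold BOf; omega) (by rw [hst.hs1]; unfold BOf; omega)
  refine (e1.seq e2).of_eq ?_ le_rfl
  simp only [postFinal, hnB]

/-! ### The output phases reach `progM` -/

/-- The cost of the output phases as a function of the bounds `O` (printed text), `k` (ticks of `sfU`),
`S = 2^L`, `m`, `u = |bin n|`, `n`. [folklore] -/
def outCostF (O k S m u n : ℕ) : ℕ :=
  3 * O + 1 + 2 + (10 * k + 3) + (k * (2 * (10 * S + 3) + 2) + 1) + 2 * (10 * m + 3) + 2 + (3 * u + 1) + (4 * u + 1) +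
    (10 * k + 3 + (k * (10 * S + 3 + 2) + 1) + 1 + (10 * n + 3) + (n * 4 + 1))

/-- The cost of the output phases, given bounds `O` for the printed text and `k` ticks of `sfU`. [folklore] -/
def outCost (z : List Bool) (O k : ℕ) : ℕ := outCostF O k (2 ^ LOf z) (mOf z) (uOf z).length (nOf z)

/-- **The output phases run from `postFinal z` to `progM z`.** [folklore] -/
theorem runs_outputs (z : List Bool) {O : ℕ} (hO : (postFinal z).o.length ≤ O) :
    Runs (output ;; outputPl) (postFinal z).regs (progM z).regs (outCost z O (postLoop z).sfU.length) := by
  obtain ⟨hI, hKp⟩ := postLoop_facts z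
  obtain ⟨j, hj⟩ := hKp.hsfU
  have hsfU : (postFinal z).sfU = List.replicate (j + 3) true := by
    show (postLoop z).sfU = _; rw [hj]; show List.replicate j true ++ [true, true, true] = _; rw [List.replicate_add]; rfl
  have hk : (postLoop z).sfU.length = j + 3 := by rw [show (postLoop z).sfU = (postFinal z).sfU from rfl, hsfU, List.length_replicate]
  have e1 := runs_output (postFinal z) (2 ^ LOf z) (j + 3) (mOf z) (hKp.hres.trans rfl) rfl (hI.hE.ht) (hI.hE.ht2) (hKp.hSU.trans rfl) hsfU (hKp.hmU.trans rfl)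
  have hnB : (postFinal z).nB = uOf z := hKp.hnB
  have e2 := runs_outputPl
    ({ postFinal z with o := [], nB := [], res := rep 2 (postFinal z).nB ++ (false :: true :: (List.replicate (2 * (2 ^ LOf z * (j + 3) + mOf z)) true ++ (false :: true :: (postFinal z).o.reverse))) } : St)
    (2 ^ LOf z) (j + 3) (nOf z) (hKp.hpl.trans rfl) rfl hI.hE.ht hI.hE.ht2 (hKp.hSU.trans rfl) hsfU (hKp.hnU.trans rfl)
  refine (e1.seq e2).of_eq ?_ ?_
  · have ht : (postFinal z).t = [] := hI.hE.ht
    simp only [progM, resOf, hnB, hk]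
    cases hpf : postFinal z
    simp only [hpf] at ht hnB ⊢
    subst ht
    rfl
  · rw [hk, hnB]; unfold outCost outCostF; omega

/-! ### The whole program -/

/-- The size bound of everything printed before the output phases. [folklore] -/
def OOf (z : List Bool) : ℕ := z.length + setupCost z + loopFinalCost z

/-- The exact cost bound of the program. [folklore] -/
def progCostExact (z : List Bool) : ℕ := setupCost z + loopFinalCost z + outCost z (OOf z) (OOf z)

/-- `outCostF` is monotone in the tick count. [folklore] -/
theorem outCostF_mono_k {O k k' S m u n : ℕ} (h : k ≤ k') : outCostF O k S m u n ≤ outCostF O k' S m u n := by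
  unfold outCostF; gcongr

/-- **The machine runs from the initial state to its model within `progCostExact`, on every input.**
[cite: BremnerJozsaShepherdPRSA2011, Thm. 1 (proof) with Def. 1] -/
theorem runs_prog (z : List Bool) : Runs prog (St.init z).regs (progM z).regs (progCostExact z) := by
  have e1 := runs_progSetup z
  have e2 := runs_loopFinal z
  have e12 := e1.seq e2
  -- the printed text and the ticks are bounded by the input plus the elapsed budget
  have hO : (postFinal z).o.length ≤ OOf z := by
    have := length_le_of_runs e12 R.o
    rw [St.init_regs, tot_init] at this
    exact this.trans (le_of_eq (by unfold OOf; ring))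
  have hk : (postLoop z).sfU.length ≤ OOf z := by
    have := length_le_of_runs e12 R.sfU
    rw [St.init_regs, tot_init] at this
    exact this.trans (le_of_eq (by unfold OOf; ring))
  have e3 := (runs_outputs z hO).mono (outCostF_mono_k (O := OOf z) (S := 2 ^ LOf z) (m := mOf z) (u := (uOf z).length) (n := nOf z) hk)
  exact (e1.seq (e2.seq e3)).of_eq rfl (le_of_eq (by unfold progCostExact outCost; ring))

/-! ### The polynomial bound -/

/-- The size bound of the gate loop as a function of `L` and `g`. [folklore] -/
def KF (L g : ℕ) : ℕ := (L + 3) * (g + 15)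

/-- The cost bound as a function of the input length alone: every size replaced by its bound
(`n, m, u, g, N ≤ ℓ`, `L ≤ ℓ + 1`, `2^L ≤ 2ℓ + 2`). [folklore] -/
def progBound (ℓ : ℕ) : ℕ :=
  setupCostF ℓ ℓ ℓ ℓ ℓ (ℓ + 1) (2 * ℓ + 2) + loopFinalCostF ℓ (ℓ + 1) ℓ (KF (ℓ + 1) ℓ) (KF (ℓ + 1) ℓ + ℓ + 1) +
    outCostF (ℓ + setupCostF ℓ ℓ ℓ ℓ ℓ (ℓ + 1) (2 * ℓ + 2) + loopFinalCostF ℓ (ℓ + 1) ℓ (KF (ℓ + 1) ℓ) (KF (ℓ + 1) ℓ + ℓ + 1))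
      (ℓ + setupCostF ℓ ℓ ℓ ℓ ℓ (ℓ + 1) (2 * ℓ + 2) + loopFinalCostF ℓ (ℓ + 1) ℓ (KF (ℓ + 1) ℓ) (KF (ℓ + 1) ℓ + ℓ + 1))
      (2 * ℓ + 2) ℓ ℓ ℓ

/-- Monotonicity of the set-up cost. [folklore] -/
theorem setupCostF_mono {ℓ u n m N L S ℓ' u' n' m' N' L' S' : ℕ} (h1 : ℓ ≤ ℓ') (h2 : u ≤ u') (h3 : n ≤ n') (h4 : m ≤ m') (h5 : N ≤ N')
    (h6 : L ≤ L') (h7 : S ≤ S') : setupCostF ℓ u n m N L S ≤ setupCostF ℓ' u' n' m' N' L' S' := by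
  unfold setupCostF; gcongr

/-- Monotonicity of the hop cost. [folklore] -/
theorem hopCost_mono {L N K L' N' K' : ℕ} (h1 : L ≤ L') (h2 : N ≤ N') (h3 : K ≤ K') : hopCost L N K ≤ hopCost L' N' K' := by
  unfold hopCost; gcongr

/-- Monotonicity of the handler cost. [folklore] -/
theorem handlerCost_mono {L N K L' N' K' : ℕ} (h1 : L ≤ L') (h2 : N ≤ N') (h3 : K ≤ K') : handlerCost L N K ≤ handlerCost L' N' K' := by
  unfold handlerCost blockCost
  have := hopCost_mono h1 h2 h3
  gcongr

/-- Monotonicity of the final-layer cost. [folklore] -/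
theorem finalCost_mono {L N B L' N' B' : ℕ} (h1 : L ≤ L') (h2 : N ≤ N') (h3 : B ≤ B') : finalCost L N B ≤ finalCost L' N' B' := by
  unfold finalCost; gcongr

/-- Monotonicity of the loop-and-final cost. [folklore] -/
theorem loopFinalCostF_mono {g L N K B g' L' N' K' B' : ℕ} (h1 : g ≤ g') (h2 : L ≤ L') (h3 : N ≤ N') (h4 : K ≤ K') (h5 : B ≤ B') :
    loopFinalCostF g L N K B ≤ loopFinalCostF g' L' N' K' B' := by
  unfold loopFinalCostF
  have := handlerCost_mono h2 h3 h4
  have := finalCost_mono h2 h3 h5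
  gcongr

/-- Monotonicity of the output cost. [folklore] -/
theorem outCostF_mono {O k S m u n O' k' S' m' u' n' : ℕ} (h1 : O ≤ O') (h2 : k ≤ k') (h3 : S ≤ S') (h4 : m ≤ m') (h5 : u ≤ u') (h6 : n ≤ n') :
    outCostF O k S m u n ≤ outCostF O' k' S' m' u' n' := by
  unfold outCostF; gcongr

/-- **The exact cost is within the bound in the input length.** [folklore] -/
theorem progCostExact_le (z : List Bool) : progCostExact z ≤ progBound z.length := by
  have hs := sizes_le z
  have hN : NOf z ≤ z.length := NOf_le z
  have hL : LOf z ≤ z.length + 1 := (LOf_le z).trans (by omega)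
  have hS : 2 ^ LOf z ≤ 2 * z.length + 2 := (two_pow_LOf_le z).trans (by omega)
  have hn : nOf z ≤ z.length := by omega
  have hm : mOf z ≤ z.length := by omega
  have hu : (uOf z).length ≤ z.length := by omega
  have hg : (toksOf z).length ≤ z.length := by omega
  have hK : KOf z ≤ KF (z.length + 1) z.length := by unfold KOf KF; gcongr
  have hB : BOf z ≤ KF (z.length + 1) z.length + z.length + 1 := by unfold BOf; omega
  have h1 : setupCost z ≤ setupCostF z.length z.length z.length z.length z.length (z.length + 1) (2 * z.length + 2) :=
    setupCostF_mono le_rfl hu hn hm hN hL hS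
  have h2 : loopFinalCost z ≤ loopFinalCostF z.length (z.length + 1) z.length (KF (z.length + 1) z.length) (KF (z.length + 1) z.length + z.length + 1) :=
    loopFinalCostF_mono hg hL hN hK hB
  have h3 : OOf z ≤ z.length + setupCostF z.length z.length z.length z.length z.length (z.length + 1) (2 * z.length + 2) +
      loopFinalCostF z.length (z.length + 1) z.length (KF (z.length + 1) z.length) (KF (z.length + 1) z.length + z.length + 1) := by
    unfold OOf; omega
  unfold progCostExact progBound outCost
  have h4 := outCostF_mono h3 h3 hS hm hu hn (k := OOf z) (O := OOf z)
  omega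

/-- The bound as a polynomial. [folklore] -/
noncomputable def progPoly : Polynomial ℕ :=
  let ℓ : Polynomial ℕ := Polynomial.X
  let K : Polynomial ℕ := (ℓ + 1 + 3) * (ℓ + 15)
  let B : Polynomial ℕ := K + ℓ + 1
  let Lp : Polynomial ℕ := ℓ + 1
  let S : Polynomial ℕ := 2 * ℓ + 2
  let setup : Polynomial ℕ := (6 * ℓ + 3) + (6 * ℓ + 3) + (3 * ℓ + 1) + (6 * ℓ + 3) + (10 * ℓ + 10 * ℓ + 6) +
    (10 * ℓ + 3 + (ℓ * (9 * ℓ + 11) + 1) + (9 * ℓ + 18)) + (10 * Lp + 3 + (Lp * 3 + 1)) +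
    (1 + (10 * Lp + 3) + (Lp * (16 * S + 7) + 1)) + (10 * Lp + 170) +
    (2 * 0 + 13 * Lp + 7 + (10 * ℓ + 3) + (ℓ * (48 * ℓ + 29 * Lp + 10 * 2 + 70) + 1)) +
    (10 * ℓ + 3 + (ℓ * (29 * Lp + 20 * 2 + 47) + 1))
  let hop : Polynomial ℕ := 15 * Lp + 10 * ℓ + 10 + ℓ * (29 * Lp + 20 * K + 47)
  let blk : Polynomial ℕ := 2 * hop + 120 * K + 200
  let hdl : Polynomial ℕ := 7 * blk + 3 * (60 * K + 200) + (8 * K + 12 * Lp + 20)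
  let fin : Polynomial ℕ := 19 * B + 12 + (2 * Lp + 13 * Lp + 6) + (10 * ℓ + 3) + (2 * (29 * Lp + 30 * B + 50) + (ℓ * (29 * Lp + 20 * B + 47) + 1)) + (10 * B + 22)
  let lf : Polynomial ℕ := ℓ * (hdl + 6) + 7 + fin
  let O : Polynomial ℕ := ℓ + setup + lf
  let out : Polynomial ℕ := 3 * O + 1 + 2 + (10 * O + 3) + (O * (2 * (10 * S + 3) + 2) + 1) + 2 * (10 * ℓ + 3) + 2 + (3 * ℓ + 1) + (4 * ℓ + 1) +
    (10 * O + 3 + (O * (10 * S + 3 + 2) + 1) + 1 + (10 * ℓ + 3) + (ℓ * 4 + 1))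
  setup + lf + out

/-- The polynomial evaluates to the bound. [folklore] -/
theorem progPoly_eval (ℓ : ℕ) : progPoly.eval ℓ = progBound ℓ := by
  simp only [progPoly, progBound, setupCostF, loopFinalCostF, handlerCost, blockCost, hopCost, finalCost, outCostF, KF,
    Polynomial.eval_add, Polynomial.eval_mul, Polynomial.eval_X, Polynomial.eval_ofNat, Polynomial.eval_one, Polynomial.eval_zero]

/-! ### The `FP` statements -/

/-- **The description printed by the machine is an `FP` function of the input stream.**
[cite: BremnerJozsaShepherdPRSA2011, Thm. 1 (proof) with Def. 1; AroraBarak2009, §6.2] -/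
theorem progFn_mem_FP : progFn ∈ FP := by
  refine Com.mem_FP prog R.inp R.res progPoly progFn fun z => ⟨(progM z).regs, Or.inl ?_, rfl⟩
  rw [← St.init_regs, progPoly_eval]
  exact (runs_prog z).mono (progCostExact_le z)

/-- **The unary post-selection length printed by the machine is an `FP` function of the input stream.**
[cite: BremnerJozsaShepherdPRSA2011, Def. 3; AroraBarak2009, §6.2] -/
theorem plFn_mem_FP : plFn ∈ FP := by
  refine Com.mem_FP prog R.inp R.pl progPoly plFn fun z => ⟨(progM z).regs, Or.inl ?_, rfl⟩
  rw [← St.init_regs, progPoly_eval]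
  exact (runs_prog z).mono (progCostExact_le z)

end Asm

end HGadget.Hop

end Literature.Computability.QuantumComplexity
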